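import Mathlib
import HarnessLib

/-!
# Fibre-mass comparison under a monotone reparametrisation (line `janus-bands`, crux `ArrangementNormalForm`, stub `stub_separateTwo`)

The analytic engine for the fibre-mass estimates of `stub_separateTwo` (separation in base
dimension `2`), valid in every base dimension because it only speaks about the FIBRES.

A Janus fibre datum consists of `k` fibre coordinates `tᵢ`, lower/upper bounds `lo i, hi i`
(another fibre coordinate or an atom `c : ι`) and optional letters `a i : Option ι`; an atom
VALUATION `α : ι → ℝ` (in the crux: the values at a base point of finitely many rational affine
forms) determines the fibre cell `cell lo hi α = {t | lo < t < hi}` and the letter block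
`∏ᵢ |tᵢ − α(aᵢ)|⁻¹`; the FIBRE MASS `lmass lo hi a α ∈ [0, ∞]` is its lower Lebesgue integral over
the cell.

**Comparison lemma** (`lmass_comp_le`, registered as `separateTwo_comparison`). Let
`ψ : ℝ → ℝ` be strictly increasing and surjective, differentiable off a finite set `B` with
derivative `ψ'`, and let `M ≥ 0` satisfy `0 ≤ ψ' ≤ M` and the RATIO condition
`ψ'(x) · |x − α c| ≤ M · |ψ x − ψ (α c)|` for every letter atom `c` (off `B`). Then
`lmass lo hi a (ψ ∘ α) ≤ M^k · lmass lo hi a α`.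
Proof: the coordinatewise map `t ↦ (ψ tᵢ)ᵢ` is injective with diagonal derivative
`diag(ψ'(tᵢ))`, maps the cell of `α` (minus the null grid over `B`) onto the cell of `ψ ∘ α`
(up to the null grid over `ψ(B)`), and the change-of-variables formula turns the letter block of
`ψ ∘ α` into `∏ᵢ ψ'(tᵢ) |ψ tᵢ − ψ(α aᵢ)|⁻¹ ≤ M^k ∏ᵢ |tᵢ − α aᵢ|⁻¹`.

Use (paper roadmap for `stub_separateTwo`, see the reply to the lead): translations, affine maps
(`M = max(slope, 1)`) and two-scale window contractions by a factor `s` (`M = O(1 + log(1/s))`)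
compare the fibre mass at nearby base points; this replaces the total-order piece dissection of
the base-dimension-`1` fibre-mass theorem (`SepZero.integrableOn_LB`) by soft comparisons with
the region where the numerator is bounded below.
-/

noncomputable section

open Set MeasureTheory
open scoped ENNReal

namespace Summit.KontsevichZagierPeriods.ArrangementNormalForm.JanusBands

namespace SepTwo

variable {k : ℕ} {ι : Type*}

/-- The fibre cell of a Janus fibre datum for the atom valuation `α`. -/
def cell (lo hi : Fin k → Fin k ⊕ ι) (α : ι → ℝ) : Set (Fin k → ℝ) :=
  {t | ∀ i, Sum.elim t α (lo i) < t i ∧ t i < Sum.elim t α (hi i)}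

/-- The letter block `∏ᵢ |tᵢ − α(aᵢ)|⁻¹` as an `ℝ≥0∞`-valued function. -/
def lblock (a : Fin k → Option ι) (α : ι → ℝ) (t : Fin k → ℝ) : ℝ≥0∞ :=
  ∏ i, (a i).elim 1 (fun c => ENNReal.ofReal |t i - α c|⁻¹)

/-- The fibre mass: lower integral of the letter block over the cell. -/
def lmass (lo hi : Fin k → Fin k ⊕ ι) (a : Fin k → Option ι) (α : ι → ℝ) : ℝ≥0∞ :=
  ∫⁻ t in cell lo hi α, lblock a α t

/-- The coordinatewise map `t ↦ (ψ tᵢ)ᵢ`. -/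
def cw (ψ : ℝ → ℝ) (t : Fin k → ℝ) : Fin k → ℝ := fun i => ψ (t i)

/-- Its derivative: the diagonal map `diag(ψ'(tᵢ))`. -/
def cwD (ψ' : ℝ → ℝ) (t : Fin k → ℝ) : (Fin k → ℝ) →L[ℝ] (Fin k → ℝ) :=
  ContinuousLinearMap.pi fun i => ψ' (t i) • ContinuousLinearMap.proj i

/-- Bound values are measurable. -/
theorem measurable_elim (α : ι → ℝ) (u : Fin k ⊕ ι) :
    Measurable fun t : Fin k → ℝ => Sum.elim t α u := by
  cases u with
  | inl j => exact measurable_pi_apply j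
  | inr c => exact measurable_const

/-- The cell is measurable. -/
theorem measurableSet_cell (lo hi : Fin k → Fin k ⊕ ι) (α : ι → ℝ) :
    MeasurableSet (cell lo hi α) := by
  have : cell lo hi α = ⋂ i, ({t | Sum.elim t α (lo i) < t i} ∩ {t | t i < Sum.elim t α (hi i)}) := by
    ext t; simp [cell]
  rw [this]
  exact MeasurableSet.iInter fun i =>
    (measurableSet_lt (measurable_elim α (lo i)) (measurable_pi_apply i)).inter
      (measurableSet_lt (measurable_pi_apply i) (measurable_elim α (hi i)))

/-- The grid over a finite set of reals is null. -/
theorem volume_grid_eq_zero (T : Finset ℝ) :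
    volume {t : Fin k → ℝ | ∃ i, t i ∈ (T : Set ℝ)} = 0 := by
  have : {t : Fin k → ℝ | ∃ i, t i ∈ (T : Set ℝ)} = ⋃ i, (fun t => t i) ⁻¹' (T : Set ℝ) := by
    ext t; simp
  rw [this, measure_iUnion_null_iff]
  intro i
  rw [volume_pi]
  exact Measure.pi_eval_preimage_null _ (T.finite_toSet.measure_zero _)

/-- The coordinatewise map has the diagonal derivative. -/
theorem hasFDerivAt_cw {ψ ψ' : ℝ → ℝ} {t : Fin k → ℝ} (h : ∀ i, HasDerivAt ψ (ψ' (t i)) (t i)) :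
    HasFDerivAt (cw ψ) (cwD ψ' t) t := by
  have h' : ∀ i, HasFDerivAt (fun x : Fin k → ℝ => ψ (x i))
      (ψ' (t i) • ContinuousLinearMap.proj (R := ℝ) (φ := fun _ : Fin k => ℝ) i) t := fun i =>
    (h i).comp_hasFDerivAt (f := fun f : Fin k → ℝ => f i) t (hasFDerivAt_apply (𝕜 := ℝ) i t)
  unfold cw cwD
  exact hasFDerivAt_pi.2 h'

/-- The determinant of the diagonal derivative. -/
theorem det_cwD (ψ' : ℝ → ℝ) (t : Fin k → ℝ) : (cwD ψ' t).det = ∏ i, ψ' (t i) := by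
  have h : (cwD ψ' t : (Fin k → ℝ) →ₗ[ℝ] (Fin k → ℝ)) =
      Matrix.toLin' (Matrix.diagonal fun i => ψ' (t i)) := by
    apply LinearMap.ext
    intro v
    ext i
    simp [cwD, Matrix.mulVec_diagonal]
  show LinearMap.det (cwD ψ' t : (Fin k → ℝ) →ₗ[ℝ] (Fin k → ℝ)) = _
  rw [h, LinearMap.det_toLin', Matrix.det_diagonal]

/-- The cell of `ψ ∘ α` is covered by the image of the cell of `α` off the grid over `B`, and the
grid over `ψ(B)`. -/
theorem cell_comp_subset [DecidableEq ℝ] (lo hi : Fin k → Fin k ⊕ ι) (α : ι → ℝ) {ψ : ℝ → ℝ}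
    (hmono : StrictMono ψ) (hsurj : Function.Surjective ψ) (B : Finset ℝ) :
    cell lo hi (ψ ∘ α) ⊆ cw ψ '' (cell lo hi α ∩ {t | ∀ i, t i ∉ (B : Set ℝ)}) ∪
      {t | ∃ i, t i ∈ ((B.image ψ : Finset ℝ) : Set ℝ)} := by
  intro t' ht'
  set e := hmono.orderIsoOfSurjective ψ hsurj with he
  have heψ : ∀ x, e x = ψ x := fun x => by rw [he, StrictMono.coe_orderIsoOfSurjective]
  set t : Fin k → ℝ := fun i => e.symm (t' i) with ht
  have hψt : ∀ i, ψ (t i) = t' i := fun i => by rw [← heψ, ht]; exact e.apply_symm_apply _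
  have hcw : cw ψ t = t' := funext hψt
  have hmem : t ∈ cell lo hi α := by
    intro i
    obtain ⟨h1, h2⟩ := ht' i
    constructor
    · revert h1
      cases lo i with
      | inl j => intro h1; exact hmono.lt_iff_lt.1 (by simpa [hψt] using h1)
      | inr c => intro h1; exact hmono.lt_iff_lt.1 (by simpa [hψt] using h1)
    · revert h2
      cases hi i with
      | inl j => intro h2; exact hmono.lt_iff_lt.1 (by simpa [hψt] using h2)
      | inr c => intro h2; exact hmono.lt_iff_lt.1 (by simpa [hψt] using h2)
  by_cases hB : ∀ i, t i ∉ (B : Set ℝ)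
  · exact Or.inl ⟨t, ⟨hmem, hB⟩, hcw⟩
  · push Not at hB
    obtain ⟨i, hi⟩ := hB
    refine Or.inr ⟨i, ?_⟩
    rw [Finset.coe_image, ← hψt i]
    exact mem_image_of_mem ψ hi

/-- Pointwise comparison of the transformed letter block. -/
theorem jac_mul_lblock_le (a : Fin k → Option ι) (α : ι → ℝ) {ψ ψ' : ℝ → ℝ} {M : ℝ} (hM : 0 ≤ M)
    (hmono : StrictMono ψ) (t : Fin k → ℝ) (h0 : ∀ i, 0 ≤ ψ' (t i)) (h1 : ∀ i, ψ' (t i) ≤ M)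
    (h2 : ∀ i c, a i = some c → ψ' (t i) * |t i - α c| ≤ M * |ψ (t i) - ψ (α c)|) :
    ENNReal.ofReal |∏ i, ψ' (t i)| * lblock a (ψ ∘ α) (cw ψ t) ≤
      ENNReal.ofReal M ^ k * lblock a α t := by
  have hprod : |∏ i, ψ' (t i)| = ∏ i, ψ' (t i) := abs_of_nonneg (Finset.prod_nonneg fun i _ => h0 i)
  rw [hprod, ENNReal.ofReal_prod_of_nonneg fun i _ => h0 i]
  unfold lblock
  rw [← Finset.prod_mul_distrib]
  have hMk : ENNReal.ofReal M ^ k = ∏ _i : Fin k, ENNReal.ofReal M := by simp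
  rw [hMk, ← Finset.prod_mul_distrib]
  refine Finset.prod_le_prod' fun i _ => ?_
  rcases hai : a i with _ | c
  · simpa using ENNReal.ofReal_le_ofReal (h1 i)
  · simp only [Option.elim_some, cw, Function.comp_apply]
    rw [← ENNReal.ofReal_mul (h0 i), ← ENNReal.ofReal_mul hM]
    refine ENNReal.ofReal_le_ofReal ?_
    by_cases hti : t i = α c
    · rw [hti]; simp
    · have hne : ψ (t i) ≠ ψ (α c) := fun h => hti (hmono.injective h)
      rw [← div_eq_mul_inv, ← div_eq_mul_inv,
        div_le_div_iff₀ (abs_pos.2 (sub_ne_zero.2 hne)) (abs_pos.2 (sub_ne_zero.2 hti))]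
      exact h2 i c hai

/-- **Comparison lemma.** See the module docstring. -/
theorem lmass_comp_le (lo hi : Fin k → Fin k ⊕ ι) (a : Fin k → Option ι) (α : ι → ℝ)
    {ψ ψ' : ℝ → ℝ} (B : Finset ℝ) {M : ℝ} (hM : 0 ≤ M) (hmono : StrictMono ψ)
    (hsurj : Function.Surjective ψ) (hderiv : ∀ x, x ∉ (B : Set ℝ) → HasDerivAt ψ (ψ' x) x)
    (h0 : ∀ x, x ∉ (B : Set ℝ) → 0 ≤ ψ' x) (h1 : ∀ x, x ∉ (B : Set ℝ) → ψ' x ≤ M)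
    (h2 : ∀ x, x ∉ (B : Set ℝ) → ∀ i c, a i = some c →
      ψ' x * |x - α c| ≤ M * |ψ x - ψ (α c)|) :
    lmass lo hi a (ψ ∘ α) ≤ ENNReal.ofReal M ^ k * lmass lo hi a α := by
  classical
  set S := cell lo hi α ∩ {t | ∀ i, t i ∉ (B : Set ℝ)} with hS_def
  set N := {t : Fin k → ℝ | ∃ i, t i ∈ ((B.image ψ : Finset ℝ) : Set ℝ)} with hN_def
  have hS : MeasurableSet S := by
    refine (measurableSet_cell lo hi α).inter ?_
    have : {t : Fin k → ℝ | ∀ i, t i ∉ (B : Set ℝ)} = ⋂ i, (fun t => t i) ⁻¹' (B : Set ℝ)ᶜ := by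
      ext t; simp
    rw [this]
    exact MeasurableSet.iInter fun i => (measurable_pi_apply i) B.measurableSet.compl
  have hN : volume N = 0 := volume_grid_eq_zero _
  have hdS : ∀ t ∈ S, HasFDerivWithinAt (cw ψ) (cwD ψ' t) S t := fun t ht =>
    (hasFDerivAt_cw fun i => hderiv _ (ht.2 i)).hasFDerivWithinAt
  have hinj : InjOn (cw ψ) S := fun t₁ _ t₂ _ h => funext fun i => hmono.injective (congr_fun h i)
  have hcov := lintegral_image_eq_lintegral_abs_det_fderiv_mul volume hS hdS hinj (lblock a (ψ ∘ α))
  calc lmass lo hi a (ψ ∘ α)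
      ≤ ∫⁻ t in cw ψ '' S ∪ N, lblock a (ψ ∘ α) t :=
        lintegral_mono_set (cell_comp_subset lo hi α hmono hsurj B)
    _ ≤ (∫⁻ t in cw ψ '' S, lblock a (ψ ∘ α) t) + ∫⁻ t in N, lblock a (ψ ∘ α) t :=
        lintegral_union_le _ _ _
    _ = ∫⁻ t in cw ψ '' S, lblock a (ψ ∘ α) t := by rw [setLIntegral_measure_zero N _ hN, add_zero]
    _ = ∫⁻ t in S, ENNReal.ofReal |(cwD ψ' t).det| * lblock a (ψ ∘ α) (cw ψ t) := hcov
    _ ≤ ∫⁻ t in S, ENNReal.ofReal M ^ k * lblock a α t := by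
        refine setLIntegral_mono' hS fun t ht => ?_
        rw [det_cwD]
        exact jac_mul_lblock_le a α hM hmono t (fun i => h0 _ (ht.2 i)) (fun i => h1 _ (ht.2 i))
          fun i c hc => h2 _ (ht.2 i) i c hc
    _ = ENNReal.ofReal M ^ k * ∫⁻ t in S, lblock a α t :=
        lintegral_const_mul' _ _ (ENNReal.pow_ne_top ENNReal.ofReal_ne_top)
    _ ≤ ENNReal.ofReal M ^ k * lmass lo hi a α :=
        mul_le_mul_right (lintegral_mono_set inter_subset_left) _

end SepTwo

/-- **Fibre-mass comparison under a monotone reparametrisation** (registered sub-goal of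
`stub_separateTwo`; literal form of `SepTwo.lmass_comp_le`): for a Janus fibre datum
(`lo`, `hi`, `a`) and an atom valuation `α`, a strictly increasing surjection `ψ : ℝ → ℝ`,
differentiable off the finite set `B` with `0 ≤ ψ' ≤ M` and `ψ'(x)|x − α c| ≤ M|ψ x − ψ(α c)|`
for all letters `c`, multiplies the fibre mass by at most `M^k`:
`mass(ψ ∘ α) ≤ M^k · mass(α)`. -/
theorem separateTwo_comparison (k : ℕ) (ι : Type) (lo hi : Fin k → Fin k ⊕ ι) (a : Fin k → Option ι) (α : ι → ℝ) (ψ ψ' : ℝ → ℝ) (B : Finset ℝ) (M : ℝ) (hM : 0 ≤ M) (hmono : StrictMono ψ) (hsurj : Function.Surjective ψ) (hderiv : ∀ x, x ∉ (B : Set ℝ) → HasDerivAt ψ (ψ' x) x) (h0 : ∀ x, x ∉ (B : Set ℝ) → 0 ≤ ψ' x) (h1 : ∀ x, x ∉ (B : Set ℝ) → ψ' x ≤ M) (h2 : ∀ x, x ∉ (B : Set ℝ) → ∀ i c, a i = some c → ψ' x * |x - α c| ≤ M * |ψ x - ψ (α c)|) : MeasureTheory.lintegral (MeasureTheory.volume.restrict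 {t : Fin k → ℝ | ∀ i, Sum.elim t (fun c => ψ (α c)) (lo i) < t i ∧ t i < Sum.elim t (fun c => ψ (α c)) (hi i)}) (fun t => ∏ i, (a i).elim 1 (fun c => ENNReal.ofReal |t i - ψ (α c)|⁻¹)) ≤ ENNReal.ofReal M ^ k * MeasureTheory.lintegral (MeasureTheory.volume.restrict {t : Fin k → ℝ | ∀ i, Sum.elim t α (lo i) < t i ∧ t i < Sum.elim t α (hi i)}) (fun t => ∏ i, (a i).elim 1 (fun c => ENNReal.ofReal |t i - α c|⁻¹)) := by
  exact SepTwo.lmass_comp_le lo hi a α B hM hmono hsurj hderiv h0 h1 h2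

end Summit.KontsevichZagierPeriods.ArrangementNormalForm.JanusBands
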